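import Literature.Geometry.Lorentzian.CoordRicciDeterminant
import Literature.Geometry.Lorentzian.CoordPinchingMinimum
import Literature.Analysis.Matrix.DetFinThreeDeriv
import HarnessLib

/-!
# The differential and the Laplacian of `det(♯Ric)` in an eigenframe (dimension three)

Calculus for the barrier `u = det(♯∘Ric)` (`CoordRicciDeterminant.ricDetAt`) of the degenerate case
of the classification of compact three-dimensional shrinking Ricci solitons (Eminenti–La
Nave–Mantegazza 2008, §3, second case), obtained WITHOUT smooth eigenvector fields: at a point `y`
with a `G_y`-orthonormal eigenframe `(e₀,e₁,e₂)` of `Ric_y`, eigenvalues `(μ₀,μ₁,μ₂)`, along the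
geodesic in a direction `X` with the parallel transport `W` of the eigenframe
(`CoordParallelFrames.lean`) one has `u(γ(s)) = det (Ric_γ(Wᵢ,Wⱼ))` (`W` stays orthonormal), the
entries have derivatives `(∇_u Ric)(Wᵢ,Wⱼ)` and `(∇²_{u,u} Ric)(Wᵢ,Wⱼ)`
(`CoordPinchingMinimum.hasDerivAt_bilin_parallel`, `hasDerivAt_cov₂At_parallel`), and the matrix is
diagonal at `s = 0`; so Jacobi's formulas (`DetFinThreeDeriv.lean`) give

* `IsMetricOn.fderiv_ricDetAt_of_eigenframe` — **`du(X) = μ₁μ₂ B₀₀ + μ₀μ₂ B₁₁ + μ₀μ₁ B₂₂`**,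
  `Bᵢᵢ = (∇_X Ric)(eᵢ,eᵢ)`;
* `IsMetricOn.hessAt_ricDetAt_of_eigenframe` — `Hess u(X,X) = μ₁μ₂ C₀₀ + μ₀μ₂ C₁₁ + μ₀μ₁ C₂₂ +
  2(μ₂B₀₀B₁₁ + μ₁B₀₀B₂₂ + μ₀B₁₁B₂₂ − μ₀B₁₂B₂₁ − μ₂B₀₁B₁₀ − μ₁B₀₂B₂₀)`, `C = ∇²_{X,X}Ric(eᵢ,eⱼ)`;
* **`IsMetricOn.lapAt_ricDetAt_of_eigenframe`** — summing over `X = e_k`: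
  `Δu = μ₁μ₂ (ΔRic)₀₀ + μ₀μ₂ (ΔRic)₁₁ + μ₀μ₁ (ΔRic)₂₂ + Σ_k 2(…)` with the rough Laplacian
  `ΔRic = lapBilinAt G (ricAt G)`;
* **`IsMetricOn.lapAt_ricDetAt_le_of_soliton`** — on a gradient soliton `Ric + Hess f = λg`, with
  `μᵢ ≥ 0` and `μ₁μ₂ > 0`: `Δu − du(∇f) − Σ_k Y_k du(e_k) ≤ μ₀ · K` with an explicit drift `Y`
  and an explicit `K` (polynomial in `λ`, the eigenvalues and the frame components of `∇Ric`) — the barrier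
  inequality that feeds E. Hopf's minimum principle in the degenerate case; it replaces the
  smooth-eigenvector computation `Δλ_min ≤ …` of the source.

Everything is proved; no definitions are introduced.

## References

* M. Eminenti, G. La Nave, C. Mantegazza, manuscripta math. 127 (2008), §3. [EminentiLanaveMantegazza2008]
* R. S. Hamilton, J. Differential Geom. 24 (1986), §4 (geodesics with parallel frames). [Hamilton1986]
-/

noncomputable section

set_option maxSynthPendingDepth 3

open Set Filter Metric Module
open scoped Topology ContDiff

namespace Literature.Geometry.Lorentzian

namespace MetricCoord

variable {E : Type*} [NormedAddCommGroup E] [NormedSpace ℝ E] [FiniteDimensional ℝ E]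
  [CompleteSpace E] {G : E → E →L[ℝ] E →L[ℝ] ℝ} {V : Set E} {y : E}

omit [FiniteDimensional ℝ E] [CompleteSpace E] in
/-- Components of a solution of the geodesic/parallel system with a `Fin 3`-frame. [folklore] -/
private theorem hasDerivAt_components₃ {q : ℝ → E × E × (Fin 3 → E)} {σ : ℝ}
    (h : HasDerivAt q (geoField G (q σ)) σ) :
    HasDerivAt (fun τ ↦ (q τ).1) ((q σ).2.1) σ ∧
      HasDerivAt (fun τ ↦ (q τ).2.1) (-chrAt G (q σ).1 (q σ).2.1 (q σ).2.1) σ ∧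
      ∀ j, HasDerivAt (fun τ ↦ (q τ).2.2 j) (-chrAt G (q σ).1 (q σ).2.1 ((q σ).2.2 j)) σ := by
  refine ⟨?_, ?_, fun j ↦ ?_⟩
  · exact ((ContinuousLinearMap.fst ℝ E (E × (Fin 3 → E))).hasFDerivAt.comp_hasDerivAt σ h :)
  · exact (((ContinuousLinearMap.fst ℝ E (Fin 3 → E)).comp
      (ContinuousLinearMap.snd ℝ E (E × (Fin 3 → E)))).hasFDerivAt.comp_hasDerivAt σ h :)
  · exact (((ContinuousLinearMap.proj j : (Fin 3 → E) →L[ℝ] E).comp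
      ((ContinuousLinearMap.snd ℝ E (Fin 3 → E)).comp
        (ContinuousLinearMap.snd ℝ E (E × (Fin 3 → E))))).hasFDerivAt.comp_hasDerivAt σ h :)

/-- **Jacobi's formulas for `u = det(♯Ric)` along the geodesic in direction `X` with the parallel
transport of an orthonormal eigenframe** (dimension three): the first derivative of `u ∘ γ` at `0`
is `μ₁μ₂B₀₀ + μ₀μ₂B₁₁ + μ₀μ₁B₂₂` and the second is Jacobi's second-order expression, where
`B = (∇_X Ric)(eᵢ,eⱼ)`, `C = (∇²_{X,X}Ric)(eᵢ,eⱼ)`; identified with `du(X)` and `Hess u(X,X)`.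
[cite: EminentiLanaveMantegazza2008, §3] [cite: Hamilton1986, §4, p. 162] -/
theorem IsMetricOn.fderiv_hessAt_ricDetAt_of_eigenframe (hG : IsMetricOn G V) (hy : y ∈ V)
    (h3 : finrank ℝ E = 3) (e : Basis (Fin 3) ℝ E)
    (he : ∀ i j, G y (e i) (e j) = if i = j then 1 else 0)
    {μ : Fin 3 → ℝ} (hμ : ∀ i w, ricAt G y (e i) w = μ i * G y (e i) w) (X : E) :
    fderiv ℝ (ricDetAt G) y X =
        μ 1 * μ 2 * cov₂At G (ricAt G) y X (e 0) (e 0) + μ 0 * μ 2 * cov₂At G (ricAt G) y X (e 1) (e 1)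
          + μ 0 * μ 1 * cov₂At G (ricAt G) y X (e 2) (e 2) ∧
      hessAt G (ricDetAt G) y X X =
        μ 1 * μ 2 * cov₃At G (cov₂At G (ricAt G)) y X X (e 0) (e 0)
          + μ 0 * μ 2 * cov₃At G (cov₂At G (ricAt G)) y X X (e 1) (e 1)
          + μ 0 * μ 1 * cov₃At G (cov₂At G (ricAt G)) y X X (e 2) (e 2)
          + 2 * (μ 2 * cov₂At G (ricAt G) y X (e 0) (e 0) * cov₂At G (ricAt G) y X (e 1) (e 1)
            + μ 1 * cov₂At G (ricAt G) y X (e 0) (e 0) * cov₂At G (ricAt G) y X (e 2) (e 2)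
            + μ 0 * cov₂At G (ricAt G) y X (e 1) (e 1) * cov₂At G (ricAt G) y X (e 2) (e 2)
            - μ 0 * cov₂At G (ricAt G) y X (e 1) (e 2) * cov₂At G (ricAt G) y X (e 2) (e 1)
            - μ 2 * cov₂At G (ricAt G) y X (e 0) (e 1) * cov₂At G (ricAt G) y X (e 1) (e 0)
            - μ 1 * cov₂At G (ricAt G) y X (e 0) (e 2) * cov₂At G (ricAt G) y X (e 2) (e 0)) := by
  classical
  have hcard : Fintype.card (Fin 3) = finrank ℝ E := by rw [Fintype.card_fin, h3]
  -- the geodesic in direction `X` with the parallel transport of `e`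
  set R₀ : ℝ := max ‖X‖ ‖(fun i : Fin 3 ↦ e i)‖ with hR₀
  obtain ⟨ε, hε, L, -, D, -, hDV, hsol⟩ :=
    hG.exists_geodesicFrames (ι := Fin 3) (K := {y}) isCompact_singleton
      (singleton_subset_iff.2 hy) R₀
  obtain ⟨q, hq0, hqd, hqD, -⟩ :=
    hsol (y, X, fun i ↦ e i) rfl (le_max_left _ _) (le_max_right _ _)
  have hIoo : ∀ σ ∈ Ioo (-ε) ε, Icc (-ε) ε ∈ 𝓝 σ := fun σ hσ ↦ Icc_mem_nhds hσ.1 hσ.2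
  have hder : ∀ σ ∈ Ioo (-ε) ε, HasDerivAt q (geoField G (q σ)) σ := fun σ hσ ↦
    (hqd σ (Ioo_subset_Icc_self hσ)).hasDerivAt (hIoo σ hσ)
  have hV : ∀ σ ∈ Ioo (-ε) ε, (q σ).1 ∈ V := fun σ hσ ↦ hDV (hqD σ (Ioo_subset_Icc_self hσ))
  have h0 : (0 : ℝ) ∈ Ioo (-ε) ε := ⟨by linarith, hε⟩
  have hq01 : (q 0).1 = y := by rw [hq0]
  have hq02 : (q 0).2.1 = X := by rw [hq0]
  have hq03 : ∀ i, (q 0).2.2 i = e i := fun i ↦ by rw [hq0]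
  -- the frame stays orthonormal on `[-ε/2, ε/2]`
  set s₀ : ℝ := ε / 2 with hs₀
  have hs₀pos : 0 < s₀ := by positivity
  have hsub : Icc (-s₀) s₀ ⊆ Ioo (-ε) ε := fun σ hσ ↦ ⟨by linarith [hσ.1], by linarith [hσ.2]⟩
  have hON : ∀ σ ∈ Icc (-s₀) s₀, ∀ i j,
      G (q σ).1 ((q σ).2.2 i) ((q σ).2.2 j) = if i = j then 1 else 0 := by
    intro σ hσ i j
    have hfd : ∀ τ ∈ Icc (-s₀) s₀,
        HasDerivAt (fun τ' ↦ G (q τ').1 ((q τ').2.2 i) ((q τ').2.2 j)) 0 τ := by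
      intro τ hτ
      obtain ⟨h1, -, h3'⟩ := hasDerivAt_components₃ (hder τ (hsub hτ))
      exact hG.hasDerivAt_pairing_parallel (γ := fun τ' ↦ (q τ').1) (u := fun τ' ↦ (q τ').2.1)
        (W := fun τ' ↦ (q τ').2.2) (hV τ (hsub hτ)) h1 h3' i j
    have hdiff : DifferentiableOn ℝ (fun τ' ↦ G (q τ').1 ((q τ').2.2 i) ((q τ').2.2 j))
        (Icc (-s₀) s₀) := fun τ hτ ↦ (hfd τ hτ).differentiableAt.differentiableWithinAt
    have hconst := constant_of_derivWithin_zero hdiff fun τ hτ ↦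
      (hfd τ (Ico_subset_Icc_self hτ)).hasDerivWithinAt.derivWithin
        (uniqueDiffOn_Icc (by linarith) τ (Ico_subset_Icc_self hτ))
    have h0mem : (0 : ℝ) ∈ Icc (-s₀) s₀ := ⟨by linarith, hs₀pos.le⟩
    rw [hconst σ hσ, ← hconst 0 h0mem, hq01, hq03, hq03, he]
  -- the entries `R i j` of `Ric` in the frame and their derivatives
  set R : Fin 3 → Fin 3 → ℝ → ℝ := fun i j σ ↦ ricAt G (q σ).1 ((q σ).2.2 i) ((q σ).2.2 j) with hR
  set R₁ : Fin 3 → Fin 3 → ℝ → ℝ := fun i j σ ↦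
    cov₂At G (ricAt G) (q σ).1 (q σ).2.1 ((q σ).2.2 i) ((q σ).2.2 j) with hR₁
  set R₂ : Fin 3 → Fin 3 → ℝ := fun i j ↦
    cov₃At G (cov₂At G (ricAt G)) y X X (e i) (e j) with hR₂
  have hRd : ∀ σ ∈ Ioo (-ε) ε, ∀ i j, HasDerivAt (R i j) (R₁ i j σ) σ := by
    intro σ hσ i j
    obtain ⟨h1, -, h3'⟩ := hasDerivAt_components₃ (hder σ hσ)
    exact IsMetricOn.hasDerivAt_bilin_parallel (G := G) (γ := fun τ ↦ (q τ).1)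
      (u := fun τ ↦ (q τ).2.1) (W := fun τ ↦ (q τ).2.2) h1 h3'
      ((hG.contDiffOn_ricAt.contDiffAt (hG.mem_nhds (hV σ hσ))).differentiableAt (by simp)) i j
  have hR₁d : ∀ i j, HasDerivAt (R₁ i j) (R₂ i j) 0 := by
    intro i j
    obtain ⟨h1, h2, h3'⟩ := hasDerivAt_components₃ (hder 0 h0)
    have h := hG.hasDerivAt_cov₂At_parallel (γ := fun τ ↦ (q τ).1) (u := fun τ ↦ (q τ).2.1)
      (W := fun τ ↦ (q τ).2.2) (hV 0 h0) h1 h2 h3'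
      (hG.contDiffOn_ricAt.contDiffAt (hG.mem_nhds (hV 0 h0))) i j
    simp only [hq01, hq02, hq03] at h
    exact h
  have hRdiag : ∀ i, R i i 0 = μ i := fun i ↦ by
    simp only [hR, hq01, hq03, ricAt_eigenframe_apply e he hμ, if_true]
  have hRoff : ∀ i j, i ≠ j → R i j 0 = 0 := fun i j hij ↦ by
    simp only [hR, hq01, hq03, ricAt_eigenframe_apply e he hμ, if_neg hij]
  -- `u ∘ γ = det R` near `0`
  have hueq : (fun σ ↦ ricDetAt G (q σ).1) =ᶠ[𝓝 0]
      fun σ ↦ Matrix.det (Matrix.of fun i j ↦ R i j σ) := by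
    filter_upwards [Icc_mem_nhds (show -s₀ < 0 by linarith) hs₀pos] with σ hσ
    exact ricDetAt_eq_det_of_orthonormal_family (hON σ hσ) hcard (hG.isInvertible _ (hV σ (hsub hσ)))
  have hueq' : ∀ σ ∈ Ioo (-s₀) s₀, (fun τ ↦ ricDetAt G (q τ).1) =ᶠ[𝓝 σ]
      fun τ ↦ Matrix.det (Matrix.of fun i j ↦ R i j τ) := by
    intro σ hσ
    filter_upwards [Ioo_mem_nhds hσ.1 hσ.2] with τ hτ
    exact ricDetAt_eq_det_of_orthonormal_family (hON τ (Ioo_subset_Icc_self hτ)) hcard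
      (hG.isInvertible _ (hV τ (hsub (Ioo_subset_Icc_self hτ))))
  -- smoothness of `u`
  have hud : ∀ σ ∈ Ioo (-ε) ε, DifferentiableAt ℝ (ricDetAt G) (q σ).1 := fun σ hσ ↦
    ((hG.contDiffOn_ricDetAt_three h3).contDiffAt (hG.mem_nhds (hV σ hσ))).differentiableAt (by simp)
  have hDud : DifferentiableAt ℝ (fderiv ℝ (ricDetAt G)) y :=
    ((((hG.contDiffOn_ricDetAt_three h3).contDiffAt (hG.mem_nhds hy))).fderiv_right (m := ∞)
      (by simp)).differentiableAt (by simp)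
  -- first derivatives of `u ∘ γ` on `Ioo (-s₀) s₀`: chain rule vs. Jacobi
  have huγ : ∀ σ ∈ Ioo (-s₀) s₀,
      HasDerivAt (fun τ ↦ ricDetAt G (q τ).1) (fderiv ℝ (ricDetAt G) (q σ).1 (q σ).2.1) σ := by
    intro σ hσ
    obtain ⟨h1, -, -⟩ := hasDerivAt_components₃ (hder σ (hsub (Ioo_subset_Icc_self hσ)))
    exact hasDerivAt_comp_curve (γ := fun τ ↦ (q τ).1) (u := fun τ ↦ (q τ).2.1)
      (hud σ (hsub (Ioo_subset_Icc_self hσ))) h1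
  -- Jacobi's expression for the first derivative of `det R`
  have hdetd := fun σ (hσ : σ ∈ Ioo (-s₀) s₀) ↦
    Literature.Analysis.Matrix.hasDerivAt_det_fin_three
      (fun i j ↦ hRd σ (hsub (Ioo_subset_Icc_self hσ)) i j)
  -- the two first-derivative functions agree on `Ioo (-s₀) s₀`
  have hfirst := fun σ (hσ : σ ∈ Ioo (-s₀) s₀) ↦
    ((huγ σ hσ).congr_of_eventuallyEq (hueq' σ hσ).symm).unique (hdetd σ hσ)
  have hs0 : (0 : ℝ) ∈ Ioo (-s₀) s₀ := ⟨by linarith, hs₀pos⟩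
  -- (1) the differential
  have hclaim1 := hfirst 0 hs0
  simp only [hRdiag, hRoff 0 1 (by decide), hRoff 0 2 (by decide), hRoff 1 0 (by decide),
    hRoff 1 2 (by decide), hRoff 2 0 (by decide), hRoff 2 1 (by decide), hR₁, hq01, hq02, hq03,
    mul_zero, zero_mul, add_zero, sub_zero] at hclaim1
  refine ⟨by rw [hclaim1]; ring, ?_⟩
  -- (2) the Hessian: second derivatives of the two (equal) first-derivative functions
  have hsecondγ : HasDerivAt (fun τ ↦ fderiv ℝ (ricDetAt G) (q τ).1 (q τ).2.1)
      (hessAt G (ricDetAt G) y X X) 0 := by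
    obtain ⟨h1, h2, -⟩ := hasDerivAt_components₃ (hder 0 h0)
    have h := hasDerivAt_fderiv_geodesic (G := G) (γ := fun τ ↦ (q τ).1)
      (u := fun τ ↦ (q τ).2.1) (by rw [hq01]; exact hDud) h1 h2
    simp only [hq01, hq02] at h
    exact h
  have hsecondJ := Literature.Analysis.Matrix.hasDerivAt_detDeriv_fin_three_diag
    (r := R) (r₁ := R₁) (r₂ := R₂) (d := μ)
    (fun i j ↦ hRd 0 h0 i j) hR₁d hRdiag hRoff
  have heqJ : (fun τ ↦ fderiv ℝ (ricDetAt G) (q τ).1 (q τ).2.1) =ᶠ[𝓝 0] fun s ↦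
      (R₁ 0 0 s * R 1 1 s * R 2 2 s + R 0 0 s * R₁ 1 1 s * R 2 2 s + R 0 0 s * R 1 1 s * R₁ 2 2 s)
      - (R₁ 0 0 s * R 1 2 s * R 2 1 s + R 0 0 s * R₁ 1 2 s * R 2 1 s + R 0 0 s * R 1 2 s * R₁ 2 1 s)
      - (R₁ 0 1 s * R 1 0 s * R 2 2 s + R 0 1 s * R₁ 1 0 s * R 2 2 s + R 0 1 s * R 1 0 s * R₁ 2 2 s)
      + (R₁ 0 1 s * R 1 2 s * R 2 0 s + R 0 1 s * R₁ 1 2 s * R 2 0 s + R 0 1 s * R 1 2 s * R₁ 2 0 s)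
      + (R₁ 0 2 s * R 1 0 s * R 2 1 s + R 0 2 s * R₁ 1 0 s * R 2 1 s + R 0 2 s * R 1 0 s * R₁ 2 1 s)
      - (R₁ 0 2 s * R 1 1 s * R 2 0 s + R 0 2 s * R₁ 1 1 s * R 2 0 s + R 0 2 s * R 1 1 s * R₁ 2 0 s) := by
    filter_upwards [Ioo_mem_nhds hs0.1 hs0.2] with σ hσ using hfirst σ hσ
  have hH := (hsecondγ.congr_of_eventuallyEq heqJ.symm).unique hsecondJ
  rw [hH]
  simp only [hR₁, hR₂, hq01, hq02, hq03]

/-- **`du(X) = μ₁μ₂ (∇_XRic)(e₀,e₀) + μ₀μ₂ (∇_XRic)(e₁,e₁) + μ₀μ₁ (∇_XRic)(e₂,e₂)`** for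
`u = det(♯Ric)` in an orthonormal eigenframe (dimension three).
[cite: EminentiLanaveMantegazza2008, §3] -/
theorem IsMetricOn.fderiv_ricDetAt_of_eigenframe (hG : IsMetricOn G V) (hy : y ∈ V)
    (h3 : finrank ℝ E = 3) (e : Basis (Fin 3) ℝ E)
    (he : ∀ i j, G y (e i) (e j) = if i = j then 1 else 0)
    {μ : Fin 3 → ℝ} (hμ : ∀ i w, ricAt G y (e i) w = μ i * G y (e i) w) (X : E) :
    fderiv ℝ (ricDetAt G) y X =
      μ 1 * μ 2 * cov₂At G (ricAt G) y X (e 0) (e 0) + μ 0 * μ 2 * cov₂At G (ricAt G) y X (e 1) (e 1)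
        + μ 0 * μ 1 * cov₂At G (ricAt G) y X (e 2) (e 2) :=
  (hG.fderiv_hessAt_ricDetAt_of_eigenframe hy h3 e he hμ X).1

/-- **The Laplacian of `u = det(♯Ric)` in an orthonormal eigenframe** (dimension three):
`Δu = μ₁μ₂(ΔRic)₀₀ + μ₀μ₂(ΔRic)₁₁ + μ₀μ₁(ΔRic)₂₂ + Σ_k 2(μ₂B₀₀B₁₁ + μ₁B₀₀B₂₂ + μ₀B₁₁B₂₂
− μ₀B₁₂B₂₁ − μ₂B₀₁B₁₀ − μ₁B₀₂B₂₀)` with `B = B^{(k)} = (∇_{e_k}Ric)(eᵢ,eⱼ)` and the rough Laplacian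
`ΔRic = lapBilinAt G (ricAt G)`. [cite: EminentiLanaveMantegazza2008, §3] [cite: Hamilton1986, §4, p. 162] -/
theorem IsMetricOn.lapAt_ricDetAt_of_eigenframe (hG : IsMetricOn G V) (hy : y ∈ V)
    (h3 : finrank ℝ E = 3) (e : Basis (Fin 3) ℝ E)
    (he : ∀ i j, G y (e i) (e j) = if i = j then 1 else 0)
    {μ : Fin 3 → ℝ} (hμ : ∀ i w, ricAt G y (e i) w = μ i * G y (e i) w) :
    lapAt G (ricDetAt G) y =
      μ 1 * μ 2 * lapBilinAt G (ricAt G) y (e 0) (e 0)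
        + μ 0 * μ 2 * lapBilinAt G (ricAt G) y (e 1) (e 1)
        + μ 0 * μ 1 * lapBilinAt G (ricAt G) y (e 2) (e 2)
        + ∑ k, 2 * (μ 2 * cov₂At G (ricAt G) y (e k) (e 0) (e 0) * cov₂At G (ricAt G) y (e k) (e 1) (e 1)
            + μ 1 * cov₂At G (ricAt G) y (e k) (e 0) (e 0) * cov₂At G (ricAt G) y (e k) (e 2) (e 2)
            + μ 0 * cov₂At G (ricAt G) y (e k) (e 1) (e 1) * cov₂At G (ricAt G) y (e k) (e 2) (e 2)
            - μ 0 * cov₂At G (ricAt G) y (e k) (e 1) (e 2) * cov₂At G (ricAt G) y (e k) (e 2) (e 1)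
            - μ 2 * cov₂At G (ricAt G) y (e k) (e 0) (e 1) * cov₂At G (ricAt G) y (e k) (e 1) (e 0)
            - μ 1 * cov₂At G (ricAt G) y (e k) (e 0) (e 2) * cov₂At G (ricAt G) y (e k) (e 2) (e 0)) := by
  have hi := hG.isInvertible y hy
  -- `Δu = Σ_k Hess u(e_k,e_k)` and `(ΔRic)(v,v) = Σ_k ∇²Ric(e_k,e_k;v,v)` in the orthonormal basis
  have hlapu : lapAt G (ricDetAt G) y = ∑ k, hessAt G (ricDetAt G) y (e k) (e k) := by
    rw [lapAt_eq_sum G e (ricDetAt G) y]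
    refine Finset.sum_congr rfl fun k _ ↦ ?_
    simp only [← hessAt_apply, sum_ginv_mul_of_orthonormal e he hi]
  have hlapR : ∀ v, lapBilinAt G (ricAt G) y v v =
      ∑ k, cov₃At G (cov₂At G (ricAt G)) y (e k) (e k) v v := fun v ↦ by
    rw [lapBilinAt_apply_eq_sum G (ricAt G) e y v v]
    refine Finset.sum_congr rfl fun k _ ↦ ?_
    rw [sum_ginv_mul_of_orthonormal e he hi (fun l ↦ cov₃At G (cov₂At G (ricAt G)) y (e k) (e l) v v) k]
  rw [hlapu, hlapR, hlapR, hlapR, Finset.mul_sum, Finset.mul_sum, Finset.mul_sum,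
    ← Finset.sum_add_distrib, ← Finset.sum_add_distrib, ← Finset.sum_add_distrib]
  refine Finset.sum_congr rfl fun k _ ↦ ?_
  rw [(hG.fderiv_hessAt_ricDetAt_of_eigenframe hy h3 e he hμ (e k)).2]

/-- The eigenframe identity `(ΔRic)(eᵢ,eᵢ) − (∇_{∇f}Ric)(eᵢ,eᵢ) = 2λμᵢ − …` for `i = 1, 2`
(`lapBilinAt_ricAt_self_of_soliton_eigenframe` on the reindexed frames).
[cite: EminentiLanaveMantegazza2008, §3 (p. 7)] -/
theorem IsMetricOn.lapBilinAt_ricAt_self_of_soliton_eigenframe₁₂ (hG : IsMetricOn G V) (hy : y ∈ V)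
    (e : Basis (Fin 3) ℝ E) (he : ∀ i j, G y (e i) (e j) = if i = j then 1 else 0)
    {μ : Fin 3 → ℝ} (hμ : ∀ i w, ricAt G y (e i) w = μ i * G y (e i) w)
    {f : E → ℝ} {lam : ℝ} (hf : ContDiffOn ℝ ∞ f V)
    (hsol : ∀ z ∈ V, ∀ v w, ricAt G z v w + hessAt G f z v w = lam * G z v w) :
    lapBilinAt G (ricAt G) y (e 1) (e 1)
          - cov₂At G (ricAt G) y (sharpAt G y (fderiv ℝ f y)) (e 1) (e 1) =
        2 * lam * μ 1 - μ 0 * (μ 1 + μ 0 - μ 2) - μ 2 * (μ 1 + μ 2 - μ 0) ∧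
      lapBilinAt G (ricAt G) y (e 2) (e 2)
          - cov₂At G (ricAt G) y (sharpAt G y (fderiv ℝ f y)) (e 2) (e 2) =
        2 * lam * μ 2 - μ 1 * (μ 2 + μ 1 - μ 0) - μ 0 * (μ 2 + μ 0 - μ 1) := by
  have key : ∀ σ : Equiv.Perm (Fin 3),
      lapBilinAt G (ricAt G) y (e (σ 0)) (e (σ 0))
          - cov₂At G (ricAt G) y (sharpAt G y (fderiv ℝ f y)) (e (σ 0)) (e (σ 0)) =
        2 * lam * μ (σ 0) - μ (σ 1) * (μ (σ 0) + μ (σ 1) - μ (σ 2))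
          - μ (σ 2) * (μ (σ 0) + μ (σ 2) - μ (σ 1)) := by
    intro σ
    set e' : Basis (Fin 3) ℝ E := e.reindex σ.symm with he'def
    have heσ : ∀ i, e' i = e (σ i) := fun i ↦ by rw [he'def, Basis.reindex_apply, Equiv.symm_symm]
    have he' : ∀ i j, G y (e' i) (e' j) = if i = j then 1 else 0 := fun i j ↦ by
      rw [heσ, heσ, he]; simp only [EmbeddingLike.apply_eq_iff_eq]
    have hμ' : ∀ i w, ricAt G y (e' i) w = (μ ∘ σ) i * G y (e' i) w := fun i w ↦ by
      rw [heσ, hμ, Function.comp_apply]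
    have h := hG.lapBilinAt_ricAt_self_of_soliton_eigenframe e' he' hμ' hy hf hsol
    simpa only [heσ, Function.comp_apply] using h
  refine ⟨?_, ?_⟩
  · have h := key (Equiv.swap 0 1)
    simpa only [Equiv.swap_apply_left, Equiv.swap_apply_right,
      show Equiv.swap (0 : Fin 3) 1 2 = 2 from by decide] using h
  · have h := key (Equiv.swap 0 2)
    simpa only [Equiv.swap_apply_left, Equiv.swap_apply_right,
      show Equiv.swap (0 : Fin 3) 2 1 = 1 from by decide] using h

/-- **The barrier inequality for `u = det(♯Ric)` on a gradient soliton** (dimension three): at a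
point with an orthonormal eigenframe whose eigenvalues satisfy `μᵢ ≥ 0`, `μ₁μ₂ > 0`
(`Ric + Hess f = λ g` near the point),

  `Δu − du(∇f) − Σ_k Y_k du(e_k) ≤ μ₀ · K`,

with the drift `Y_k = 2(μ₂B⁽ᵏ⁾₁₁ + μ₁B⁽ᵏ⁾₂₂)/(μ₁μ₂)` and
`K = μ₁μ₂(2λ − μ₁ − μ₂) + μ₂T₁ + μ₁T₂ + Σ_k 2(B⁽ᵏ⁾₁₁B⁽ᵏ⁾₂₂ − (B⁽ᵏ⁾₁₂)²)`,
`B⁽ᵏ⁾ᵢⱼ = (∇_{e_k}Ric)(eᵢ,eⱼ)`, `Tᵢ = (ΔRic − ∇_{∇f}Ric)(eᵢ,eᵢ) = 2λμᵢ − 2(Rm∗Ric)ᵢᵢ` (a polynomial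
in the eigenvalues, `lapBilinAt_ricAt_self_of_soliton_eigenframe₁₂`): the exact value is
`μ₀K − μ₁μ₂(μ₁−μ₂)² − Σ_k (2μ₀P_k²/(μ₁μ₂) + 2μ₂(B⁽ᵏ⁾₀₁)² + 2μ₁(B⁽ᵏ⁾₀₂)²)` by
`lapAt_ricDetAt_of_eigenframe` and `fderiv_ricDetAt_of_eigenframe`. This replaces the
smooth-eigenvector computation `Δλ_min ≤ …` of the source.
[cite: EminentiLanaveMantegazza2008, §3, p. 8] -/
theorem IsMetricOn.lapAt_ricDetAt_le_of_soliton (hG : IsMetricOn G V) (hy : y ∈ V)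
    (h3 : finrank ℝ E = 3) (e : Basis (Fin 3) ℝ E)
    (he : ∀ i j, G y (e i) (e j) = if i = j then 1 else 0)
    {μ : Fin 3 → ℝ} (hμ : ∀ i w, ricAt G y (e i) w = μ i * G y (e i) w)
    {f : E → ℝ} {lam : ℝ} (hf : ContDiffOn ℝ ∞ f V)
    (hsol : ∀ z ∈ V, ∀ v w, ricAt G z v w + hessAt G f z v w = lam * G z v w)
    (h0 : 0 ≤ μ 0) (h1 : 0 ≤ μ 1) (h2 : 0 ≤ μ 2) (h12 : 0 < μ 1 * μ 2) :
    lapAt G (ricDetAt G) y - fderiv ℝ (ricDetAt G) y (sharpAt G y (fderiv ℝ f y))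
        - ∑ k, 2 * (μ 2 * cov₂At G (ricAt G) y (e k) (e 1) (e 1)
            + μ 1 * cov₂At G (ricAt G) y (e k) (e 2) (e 2)) / (μ 1 * μ 2)
            * fderiv ℝ (ricDetAt G) y (e k) ≤
      μ 0 * (μ 1 * μ 2 * (2 * lam - μ 1 - μ 2)
        + μ 2 * (2 * lam * μ 1 - μ 0 * (μ 1 + μ 0 - μ 2) - μ 2 * (μ 1 + μ 2 - μ 0))
        + μ 1 * (2 * lam * μ 2 - μ 0 * (μ 2 + μ 0 - μ 1) - μ 1 * (μ 2 + μ 1 - μ 0))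
        + ∑ k, 2 * (cov₂At G (ricAt G) y (e k) (e 1) (e 1) * cov₂At G (ricAt G) y (e k) (e 2) (e 2)
            - cov₂At G (ricAt G) y (e k) (e 1) (e 2) ^ 2)) := by
  have hlap := hG.lapAt_ricDetAt_of_eigenframe hy h3 e he hμ
  have hD := fun X ↦ hG.fderiv_ricDetAt_of_eigenframe hy h3 e he hμ X
  have hL0 := hG.lapBilinAt_ricAt_self_of_soliton_eigenframe e he hμ hy hf hsol
  obtain ⟨hL1, hL2⟩ := hG.lapBilinAt_ricAt_self_of_soliton_eigenframe₁₂ hy e he hμ hf hsol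
  have hLB0 : lapBilinAt G (ricAt G) y (e 0) (e 0) =
      cov₂At G (ricAt G) y (sharpAt G y (fderiv ℝ f y)) (e 0) (e 0)
        + (2 * lam * μ 0 - μ 1 * (μ 0 + μ 1 - μ 2) - μ 2 * (μ 0 + μ 2 - μ 1)) := by linarith
  have hLB1 : lapBilinAt G (ricAt G) y (e 1) (e 1) =
      cov₂At G (ricAt G) y (sharpAt G y (fderiv ℝ f y)) (e 1) (e 1)
        + (2 * lam * μ 1 - μ 0 * (μ 1 + μ 0 - μ 2) - μ 2 * (μ 1 + μ 2 - μ 0)) := by linarith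
  have hLB2 : lapBilinAt G (ricAt G) y (e 2) (e 2) =
      cov₂At G (ricAt G) y (sharpAt G y (fderiv ℝ f y)) (e 2) (e 2)
        + (2 * lam * μ 2 - μ 0 * (μ 2 + μ 0 - μ 1) - μ 1 * (μ 2 + μ 1 - μ 0)) := by linarith
  have hB10 : ∀ k, cov₂At G (ricAt G) y (e k) (e 1) (e 0) = cov₂At G (ricAt G) y (e k) (e 0) (e 1) :=
    fun k ↦ hG.cov₂At_ricAt_symm hy _ _ _
  have hB20 : ∀ k, cov₂At G (ricAt G) y (e k) (e 2) (e 0) = cov₂At G (ricAt G) y (e k) (e 0) (e 2) :=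
    fun k ↦ hG.cov₂At_ricAt_symm hy _ _ _
  have hB21 : ∀ k, cov₂At G (ricAt G) y (e k) (e 2) (e 1) = cov₂At G (ricAt G) y (e k) (e 1) (e 2) :=
    fun k ↦ hG.cov₂At_ricAt_symm hy _ _ _
  have hne : μ 1 * μ 2 ≠ 0 := h12.ne'
  -- the non-positive remainder
  have hnonneg : 0 ≤ μ 1 * μ 2 * (μ 1 - μ 2) ^ 2
      + ∑ k, (2 * μ 0 * (μ 2 * cov₂At G (ricAt G) y (e k) (e 1) (e 1)
          + μ 1 * cov₂At G (ricAt G) y (e k) (e 2) (e 2)) ^ 2 / (μ 1 * μ 2)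
        + 2 * μ 2 * cov₂At G (ricAt G) y (e k) (e 0) (e 1) ^ 2
        + 2 * μ 1 * cov₂At G (ricAt G) y (e k) (e 0) (e 2) ^ 2) := by
    refine add_nonneg (mul_nonneg h12.le (sq_nonneg _)) (Finset.sum_nonneg fun k _ ↦ ?_)
    refine add_nonneg (add_nonneg (div_nonneg ?_ h12.le) ?_) ?_
    · exact mul_nonneg (mul_nonneg two_pos.le h0) (sq_nonneg _)
    · exact mul_nonneg (mul_nonneg two_pos.le h2) (sq_nonneg _)
    · exact mul_nonneg (mul_nonneg two_pos.le h1) (sq_nonneg _)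
  -- the exact value of the left-hand side
  have hexact : lapAt G (ricDetAt G) y - fderiv ℝ (ricDetAt G) y (sharpAt G y (fderiv ℝ f y))
        - ∑ k, 2 * (μ 2 * cov₂At G (ricAt G) y (e k) (e 1) (e 1)
            + μ 1 * cov₂At G (ricAt G) y (e k) (e 2) (e 2)) / (μ 1 * μ 2)
            * fderiv ℝ (ricDetAt G) y (e k) =
      μ 0 * (μ 1 * μ 2 * (2 * lam - μ 1 - μ 2)
        + μ 2 * (2 * lam * μ 1 - μ 0 * (μ 1 + μ 0 - μ 2) - μ 2 * (μ 1 + μ 2 - μ 0))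
        + μ 1 * (2 * lam * μ 2 - μ 0 * (μ 2 + μ 0 - μ 1) - μ 1 * (μ 2 + μ 1 - μ 0))
        + ∑ k, 2 * (cov₂At G (ricAt G) y (e k) (e 1) (e 1) * cov₂At G (ricAt G) y (e k) (e 2) (e 2)
            - cov₂At G (ricAt G) y (e k) (e 1) (e 2) ^ 2))
      - (μ 1 * μ 2 * (μ 1 - μ 2) ^ 2
        + ∑ k, (2 * μ 0 * (μ 2 * cov₂At G (ricAt G) y (e k) (e 1) (e 1)
            + μ 1 * cov₂At G (ricAt G) y (e k) (e 2) (e 2)) ^ 2 / (μ 1 * μ 2)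
          + 2 * μ 2 * cov₂At G (ricAt G) y (e k) (e 0) (e 1) ^ 2
          + 2 * μ 1 * cov₂At G (ricAt G) y (e k) (e 0) (e 2) ^ 2)) := by
    have hne1 : μ 1 ≠ 0 := fun h ↦ hne (by rw [h, zero_mul])
    have hne2 : μ 2 ≠ 0 := fun h ↦ hne (by rw [h, mul_zero])
    rw [hlap, hLB0, hLB1, hLB2, hD]
    simp only [hD, Fin.sum_univ_three, hB10, hB20, hB21]
    field_simp
    ring
  linarith [hexact, hnonneg]

end MetricCoord


end Literature.Geometry.Lorentzian

end
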